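import Summits.RiemannHypothesis.RiemannHypothesis.Theorems.MotivicDoorAWSIntegralGreedy
import Summits.RiemannHypothesis.RiemannHypothesis.Theorems.MotivicDoorAWSIntegralAux

/-!
# AWS axiom system — integrality is free: an integral canonical carrier

HONEST LABEL (verbatim on every AWS file).  One-way implication from a strengthened,
prime-side-only axiom system; the existence of such an object is NOT claimed and is the located
gap; the converse (RH ⇒ existence) is out of scope and, for this axiom system, tautological
rather than informative (AXIOM-CONTENT.md §2; `riemannHypothesis_iff_exists_tautologicalCarrier`).
Framing: lottery ticket at the motivic door; RH probability
negligible; consolation prizes are real: a new semi-local Weil-positivity theorem, or a located gap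
in the Connes–Consani programme, plus the ff-door theorem.

## The theorem (PROVED, RH-free)

`IntegralCarrier.exists_integral_generatingFamily`: there is a generating family `F` (countable
index, with the FORCING/density property of `ArithmeticWeilSurface.gen`) all of whose prime-side
data are INTEGERS — every mass `∫ F_k d*u`, `∫ F_k du` and every real cross term
`Re W(F_j ⋆ F̃_k)` of Weil's functional lies in `ℤ`.  Consequently
(`IntegralCarrier.exists_integral_primeLattice`) the decreed pairing `primeInter` of its canonical
prime-side carrier (`PrimeSideLattice`) is `ℤ`-valued on the whole free lattice, and
(`IntegralCarrier.riemannHypothesis_iff_exists_integral_carrier`)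

  `RiemannHypothesis ↔ ∃ X : ArithmeticWeilSurface, ∀ x y : X.L, ∃ n : ℤ, X.inter x y = n`.

READING (AXIOM-CONTENT.md §3, "integral lattice with symmetric ℤ-pairing"): requiring the
intersection pairing of an arithmetic Weil surface to be INTEGRAL adds nothing — a tautological
(RH-built) carrier can be chosen with an honest `ℤ`-valued symmetric pairing.  Integrality is
therefore NOT the missing geometric axiom; the located gap is unchanged (an independently
constructed object satisfying `hodge`).

## Construction

Universe family `U = monomial bumps ⊔ auxiliary bumps β` (`IntegralAux.exists_auxFamily`, in a
window where `Re Q ≥ ‖·‖₂²`); real coefficient space `V = U.ι →₀ ℝ` with the canonical carrier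
form `B = U.Wc` (`CanonicalCarrierForm`), auxiliary block `V₀` (positive definite, infinite
dimensional, masses onto `ℝ²`: `IntegralAux`); targets `u_k` = an enumeration of all
`N⁻¹ · (integer combination of monomial bumps)` paired with all precisions `1/(m+1)`; the greedy
engine `IntegralGreedy.exists_integral_sequence` returns `φ_k ∈ u_k + V₀`, `C¹`-close to `u_k`,
with all masses and pairings of `M_k φ_k` integral; `F_k := rtest (M_k φ_k)`.  Density of `F`:
a real test function is approximated by some `u_k`'s function (monomial-bump density) to any
precision, hence by `φ_k = M_k⁻¹ · F_k`, on the window `[-(R+1), R+1]`.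
-/

noncomputable section

open Complex Set MeasureTheory Filter Literature.NumberTheory.LFunctions
open Literature.NumberTheory.ConnesConsani2019
open Summit.RiemannHypothesis.RiemannHypothesis.Theorems.PfPersistence
open scoped BigOperators ComplexConjugate ContDiff

namespace Summit.RiemannHypothesis.RiemannHypothesis.Theorems.MotivicDoor.AWS

-- the mandated namespace repeats a component (single-conjunct summit)
set_option linter.dupNamespace false

namespace IntegralCarrier

/-! ## §6 `C¹`-smallness of finite perturbations -/

/-- **Small perturbations stay `C¹`-close.**  For coefficient vectors `u` and `F a` (`a` in a
finite type) and `δ₀ > 0` there is `δ > 0` such that `|t a| ≤ δ` for all `a` forces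
`rtest (u + Σ t_a F_a)` to be `δ₀`-close to `rtest u` together with first derivatives. -/
theorem rtest_perturb_small (G : GeneratingFamily) (u : G.ι →₀ ℝ) {δ₀ : ℝ} (hδ₀ : 0 < δ₀)
    {κ : Type*} [Fintype κ] (F : κ → (G.ι →₀ ℝ)) :
    ∃ δ : ℝ, 0 < δ ∧ ∀ t : κ → ℝ, (∀ a, |t a| ≤ δ) →
      (∀ s, |G.rtest (u + ∑ a, t a • F a) s - G.rtest u s| ≤ δ₀) ∧
      (∀ s, |deriv (G.rtest (u + ∑ a, t a • F a)) s - deriv (G.rtest u) s| ≤ δ₀) := by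
  classical
  -- uniform bounds for each `rtest (F a)` and its derivative
  have hb : ∀ a, ∃ C, 0 ≤ C ∧ (∀ s, |G.rtest (F a) s| ≤ C) ∧
      ∀ s, |deriv (G.rtest (F a)) s| ≤ C := by
    intro a
    have hW := G.isWeilTest_rtest (F a)
    have hcd := contDiff_of_isWeilTest_ofReal hW
    have hcs : HasCompactSupport (G.rtest (F a)) := hasCompactSupport_of_isWeilTest hW
    obtain ⟨C₁, hC₁⟩ := hcd.continuous.bounded_above_of_compact_support hcs
    obtain ⟨C₂, hC₂⟩ :=
      (hcd.continuous_deriv (by simp)).bounded_above_of_compact_support hcs.deriv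
    refine ⟨max C₁ C₂, (norm_nonneg _).trans ((hC₁ 0).trans (le_max_left _ _)),
      fun s ↦ ?_, fun s ↦ ?_⟩
    · exact (Real.norm_eq_abs _ ▸ hC₁ s).trans (le_max_left _ _)
    · exact (Real.norm_eq_abs _ ▸ hC₂ s).trans (le_max_right _ _)
  choose C hC0 hC hC' using hb
  have hsum0 : 0 ≤ ∑ a, C a := Finset.sum_nonneg fun a _ ↦ hC0 a
  refine ⟨δ₀ / (1 + ∑ a, C a), by positivity, fun t ht ↦ ?_⟩
  have hδ : δ₀ / (1 + ∑ a, C a) * ∑ a, C a ≤ δ₀ := by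
    rw [div_mul_eq_mul_div, div_le_iff₀ (by positivity)]
    nlinarith
  have hdiff : ∀ a, Differentiable ℝ (G.rtest (F a)) := fun a ↦
    differentiable_of_isWeilTest_ofReal (G.isWeilTest_rtest (F a))
  have hdu : Differentiable ℝ (G.rtest u) := differentiable_of_isWeilTest_ofReal
    (G.isWeilTest_rtest u)
  have hlin : G.rtest (u + ∑ a, t a • F a) =
      G.rtest u + ∑ a, fun y ↦ t a * G.rtest (F a) y := by
    rw [G.rtest_add, IntegralAux.rtest_finset_sum G]
    congr 1
    funext s
    simp only [Finset.sum_apply, G.rtest_smul, Pi.smul_apply, smul_eq_mul]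
  have hlin' : ∀ s, G.rtest (u + ∑ a, t a • F a) s =
      G.rtest u s + ∑ a, t a * G.rtest (F a) s := fun s ↦ by
    rw [hlin, Pi.add_apply, Finset.sum_apply]
  have hder : ∀ s, deriv (G.rtest (u + ∑ a, t a • F a)) s =
      deriv (G.rtest u) s + ∑ a, t a * deriv (G.rtest (F a)) s := fun s ↦ by
    rw [hlin]
    exact ((hdu s).hasDerivAt.add (HasDerivAt.sum (u := Finset.univ)
      fun a _ ↦ ((hdiff a s).hasDerivAt.const_mul (t a)))).deriv
  have hbound : ∀ (g : κ → ℝ), (∀ a, |g a| ≤ C a) → |∑ a, t a * g a| ≤ δ₀ := fun g hg ↦ by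
    calc |∑ a, t a * g a| ≤ ∑ a, |t a * g a| := Finset.abs_sum_le_sum_abs _ _
      _ ≤ ∑ a, δ₀ / (1 + ∑ a, C a) * C a := Finset.sum_le_sum fun a _ ↦ by
          rw [abs_mul]; exact mul_le_mul (ht a) (hg a) (abs_nonneg _) (by positivity)
      _ = δ₀ / (1 + ∑ a, C a) * ∑ a, C a := by rw [Finset.mul_sum]
      _ ≤ δ₀ := hδ
  refine ⟨fun s ↦ ?_, fun s ↦ ?_⟩
  · rw [hlin', add_sub_cancel_left]
    exact hbound (fun a ↦ G.rtest (F a) s) fun a ↦ hC a s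
  · rw [hder, add_sub_cancel_left]
    exact hbound (fun a ↦ deriv (G.rtest (F a)) s) fun a ↦ hC' a s

/-! ## §7 Extending a generating family keeps density -/

/-- Integer combinations transported along an injective reindexing. -/
theorem testCombination_mapDomain {ι₁ ι₂ : Type*} (φ : ι₂ → ℝ → ℝ) (f : ι₁ → ι₂)
    (hf : Function.Injective f) (c : ι₁ →₀ ℤ) :
    testCombination φ (c.mapDomain f) = testCombination (φ ∘ f) c := by
  funext t
  simp only [testCombination]
  rw [Finsupp.sum_mapDomain_index_inj hf]
  rfl

/-- **Extension keeps density.**  The family `Sum.elim F.φ φ₂` obtained by adjoining arbitrary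
new generators `φ₂` to a generating family `F` still has the density (forcing) property: use
`F`'s approximants, reindexed along `Sum.inl`. -/
theorem sumElim_dense (F : GeneratingFamily) {ι₂ : Type} (φ₂ : ι₂ → ℝ → ℝ) :
    ∀ u : ℝ → ℝ, IsWeilTest (fun t ↦ (u t : ℂ)) →
      ∃ R : ℝ, 0 < R ∧ tsupport u ⊆ Icc (-R) R ∧
        ∀ ε : ℝ, 0 < ε → ∃ (N : ℕ) (c : (F.ι ⊕ ι₂) →₀ ℤ), 0 < N ∧
          tsupport (testCombination (Sum.elim F.φ φ₂) c) ⊆ Icc (-R) R ∧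
          (∀ t, |u t - (N : ℝ)⁻¹ * testCombination (Sum.elim F.φ φ₂) c t| ≤ ε) ∧
          (∀ t, |deriv u t - deriv (fun s ↦ (N : ℝ)⁻¹ *
            testCombination (Sum.elim F.φ φ₂) c s) t| ≤ ε) := by
  intro u hu
  obtain ⟨R, hR, hsu, h⟩ := F.dense u hu
  refine ⟨R, hR, hsu, fun ε hε ↦ ?_⟩
  obtain ⟨N, c, hN, hsc, h0, h1⟩ := h ε hε
  refine ⟨N, c.mapDomain Sum.inl, hN, ?_⟩
  rw [testCombination_mapDomain _ _ Sum.inl_injective, Sum.elim_comp_inl]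
  exact ⟨hsc, h0, h1⟩

/-- Coefficient vectors supported on a block of generators all supported in a closed set `S`
have `rtest` supported in `S`. -/
theorem tsupport_rtest_subset (G : GeneratingFamily) {J : Type*} (e : J → G.ι) {S : Set ℝ}
    (hS : IsClosed S) (hsupp : ∀ j, tsupport (G.φ (e j)) ⊆ S) (x : G.ι →₀ ℝ)
    (hx : x ∈ Finsupp.supported ℝ ℝ (Set.range e)) : tsupport (G.rtest x) ⊆ S := by
  refine closure_minimal (fun t (ht : G.rtest x t ≠ 0) ↦ by_contra fun hmem ↦ ht ?_) hS
  rw [IntegralAux.rtest_apply_eq_sum]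
  refine Finset.sum_eq_zero fun i hi ↦ ?_
  obtain ⟨j, rfl⟩ := (Finsupp.mem_supported ℝ x).mp hx (Finset.mem_coe.mpr hi)
  rw [image_eq_zero_of_notMem_tsupport (fun h ↦ hmem (hsupp j h)), mul_zero]

/-! ## §8 The integral generating family -/

/-- **INTEGRALITY IS FREE (RH-free).**  There is a generating family — countable index, every
member a real Weil test function, with the density (forcing) property — all of whose prime-side
data are integers: the masses `∫ F_k d*u`, `∫ F_k du` and the real cross terms `Re W(F_j ⋆ F̃_k)`
of Weil's explicit-formula functional. -/
theorem exists_integral_generatingFamily : ∃ F : GeneratingFamily, Countable F.ι ∧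
    (∀ i, ∃ z : ℤ, massDstar (toMul (F.φ i)) = z) ∧
    (∀ i, ∃ z : ℤ, massDu (toMul (F.φ i)) = z) ∧
    ∀ i j, ∃ z : ℤ, (weilCross (fun t ↦ (F.φ i t : ℂ)) (fun t ↦ (F.φ j t : ℂ))).re = z := by
  classical
  -- the window and the auxiliary bumps
  obtain ⟨a, ha, ha1, hwin⟩ := IntegralAux.exists_posWindow
  obtain ⟨β, hβW, hβsupp, hβdisj, hβne, hβnn, hβplus, hβminus⟩ := IntegralAux.exists_auxFamily ha
  -- the universe family
  let U : GeneratingFamily :=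
    { ι := (ℕ × ℕ) ⊕ (ℕ × Bool)
      φ := Sum.elim monomialBumpFamily.φ β
      isWeilTest := fun i ↦ by
        rcases i with i | j
        · exact monomialBumpFamily.isWeilTest i
        · exact hβW j
      dense := sumElim_dense monomialBumpFamily β }
  have hUφ : ∀ j, U.φ (Sum.inr j) = β j := fun j ↦ rfl
  -- the engine's data
  let V₀ : Submodule ℝ (U.ι →₀ ℝ) :=
    Finsupp.supported ℝ ℝ (Set.range (Sum.inr : ℕ × Bool → U.ι))
  have hpos : ∀ x ∈ V₀, x ≠ 0 → 0 < U.Wc x x := fun x hx hx0 ↦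
    IntegralAux.Wc_pos_of_supported U hwin Sum.inr β hUφ hβsupp hβdisj hβne x hx hx0
  have hbig : ∀ s : Finset (U.ι →₀ ℝ), ∃ w ∈ V₀, w ∉ Submodule.span ℝ (s : Set (U.ι →₀ ℝ)) :=
    fun s ↦ IntegralAux.exists_fresh_single Sum.inr Sum.inr_injective s
  let L : Fin 2 → (U.ι →₀ ℝ) →ₗ[ℝ] ℝ := ![U.M₀, U.M₁]
  have hL : ∀ y : Fin 2 → ℝ, ∃ x ∈ V₀, ∀ i, L i x = y i := fun y ↦
    IntegralAux.masses_surjective U Sum.inr β hUφ hβW hβnn hβne (0, true) (0, false)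
      (hβplus 0) (hβminus 0) y
  -- the targets: all `N⁻¹ · (integer combination of monomial bumps)`, each at all precisions
  obtain ⟨enum, henum⟩ := exists_surjective_nat (ℕ × ((ℕ × ℕ) →₀ ℤ))
  let tgt : ℕ → ℕ × ((ℕ × ℕ) →₀ ℤ) := fun k ↦ enum (Nat.unpair k).1
  let δk : ℕ → ℝ := fun k ↦ 1 / (((Nat.unpair k).2 : ℝ) + 1)
  have hδk : ∀ k, 0 < δk k := fun k ↦ by positivity
  let u : ℕ → (U.ι →₀ ℝ) := fun k ↦
    (((tgt k).1 + 1 : ℕ) : ℝ)⁻¹ • U.intCoeffs (((tgt k).2).mapDomain Sum.inl)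
  have hu : ∀ k, U.rtest (u k) =
      fun s ↦ (((tgt k).1 + 1 : ℕ) : ℝ)⁻¹ * testCombination monomialBumpFamily.φ (tgt k).2 s := by
    intro k
    change U.rtest ((((tgt k).1 + 1 : ℕ) : ℝ)⁻¹ • U.intCoeffs (((tgt k).2).mapDomain Sum.inl)) = _
    rw [U.rtest_smul, U.rtest_intCoeffs, testCombination_mapDomain _ _ Sum.inl_injective]
    rfl
  let N : ℕ → Set (U.ι →₀ ℝ) := fun k ↦
    {x | (∀ s, |U.rtest x s - U.rtest (u k) s| ≤ δk k) ∧
      ∀ s, |deriv (U.rtest x) s - deriv (U.rtest (u k)) s| ≤ δk k}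
  have hN : ∀ (k : ℕ) (κ : Type) [Fintype κ] (F : κ → (U.ι →₀ ℝ)), (∀ a, F a ∈ V₀) →
      ∃ δ : ℝ, 0 < δ ∧ ∀ t : κ → ℝ, (∀ a, |t a| ≤ δ) → u k + ∑ a, t a • F a ∈ N k := by
    intro k κ _ F _
    obtain ⟨δ, hδ, h⟩ := rtest_perturb_small U (u k) (hδk k) F
    exact ⟨δ, hδ, fun t ht ↦ h t ht⟩
  -- run the greedy engine
  obtain ⟨φ, M, hM, hV₀, hNk, hLint, hBint⟩ :=
    IntegralGreedy.exists_integral_sequence V₀ U.Wc U.Wc_comm hpos hbig L hL u N hN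
  -- the final family
  let ψ : ℕ → (U.ι →₀ ℝ) := fun k ↦ (M k : ℝ) • φ k
  have hψ : ∀ k, U.rtest (ψ k) = fun s ↦ (M k : ℝ) * U.rtest (φ k) s := fun k ↦ by
    change U.rtest ((M k : ℝ) • φ k) = _; rw [U.rtest_smul]; rfl
  have hφsplit : ∀ k, U.rtest (φ k) = U.rtest (u k) + U.rtest (φ k - u k) := fun k ↦ by
    rw [← U.rtest_add, add_sub_cancel]
  -- supports
  have hβa : ∀ j, tsupport (U.φ (Sum.inr j)) ⊆ Icc (-a) a := fun j ↦ hβsupp j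
  have hsuppV₀ : ∀ k, tsupport (U.rtest (φ k - u k)) ⊆ Icc (-a) a := fun k ↦
    tsupport_rtest_subset U Sum.inr isClosed_Icc hβa _ (hV₀ k)
  refine ⟨⟨ℕ, fun k ↦ U.rtest (ψ k), fun k ↦ U.isWeilTest_rtest _, fun v hv ↦ ?_⟩,
    (inferInstance : Countable ℕ), fun k ↦ ?_, fun k ↦ ?_, fun j k ↦ ?_⟩
  · -- DENSITY of the final family
    obtain ⟨R, hR, hsv, happrox⟩ := monomialBumpFamily.dense v hv
    have hIcc : Icc (-R) R ⊆ Icc (-(R + 1)) (R + 1) := Icc_subset_Icc (by linarith) (by linarith)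
    have hIcc' : Icc (-a) a ⊆ Icc (-(R + 1)) (R + 1) := Icc_subset_Icc (by linarith) (by linarith)
    refine ⟨R + 1, by linarith, hsv.trans hIcc, fun ε hε ↦ ?_⟩
    obtain ⟨N₀, c₀, hN₀, hsc₀, h0, h1⟩ := happrox (ε / 2) (half_pos hε)
    obtain ⟨n₀, rfl⟩ : ∃ n₀, N₀ = n₀ + 1 := ⟨N₀ - 1, by omega⟩
    obtain ⟨i, hi⟩ := henum (n₀, c₀)
    obtain ⟨m, hm⟩ := exists_nat_one_div_lt (half_pos hε)
    set k : ℕ := Nat.pair i m with hk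
    have htgt : tgt k = (n₀, c₀) := by
      change enum (Nat.unpair (Nat.pair i m)).1 = _; rw [Nat.unpair_pair]; exact hi
    have hδkm : δk k = 1 / ((m : ℝ) + 1) := by
      change 1 / (((Nat.unpair (Nat.pair i m)).2 : ℝ) + 1) = _; rw [Nat.unpair_pair]
    have huk : U.rtest (u k) = fun s ↦ ((n₀ + 1 : ℕ) : ℝ)⁻¹ *
        testCombination monomialBumpFamily.φ c₀ s := by
      rw [hu k, htgt]
    -- the witness: `N := M k`, `c := single k 1`, so that `N⁻¹ · F_c = rtest (φ k)`
    have hcomb : testCombination (fun k ↦ U.rtest (ψ k)) (Finsupp.single k 1) = U.rtest (ψ k) :=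
      ForcingUp.testCombination_single _ k
    have hMk : (M k : ℝ) ≠ 0 := Nat.cast_ne_zero.mpr (hM k).ne'
    have hscaled : (fun s ↦ ((M k : ℕ) : ℝ)⁻¹ *
        testCombination (fun k ↦ U.rtest (ψ k)) (Finsupp.single k 1) s) = U.rtest (φ k) := by
      funext s; rw [hcomb, hψ]; field_simp
    obtain ⟨hN0, hN1⟩ := hNk k
    refine ⟨M k, Finsupp.single k 1, hM k, ?_, fun t ↦ ?_, fun t ↦ ?_⟩
    · -- support of `F_k = M_k · (rtest u_k + rtest (φ_k - u_k))`
      rw [hcomb, hψ, hφsplit]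
      refine (tsupport_mul_subset_right (f := fun _ : ℝ ↦ (M k : ℝ))
        (g := U.rtest (u k) + U.rtest (φ k - u k))).trans ((tsupport_add _ _).trans
          (union_subset ?_ ((hsuppV₀ k).trans hIcc')))
      rw [huk]
      exact (tsupport_mul_subset_right (f := fun _ : ℝ ↦ ((n₀ + 1 : ℕ) : ℝ)⁻¹)
        (g := testCombination monomialBumpFamily.φ c₀)).trans (hsc₀.trans hIcc)
    · -- values
      have e1 : ((M k : ℕ) : ℝ)⁻¹ * testCombination (fun k ↦ U.rtest (ψ k))
          (Finsupp.single k 1) t = U.rtest (φ k) t := congrFun hscaled t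
      have e2 := h0 t
      rw [show ((n₀ + 1 : ℕ) : ℝ)⁻¹ * testCombination monomialBumpFamily.φ c₀ t
        = U.rtest (u k) t from (congrFun huk t).symm] at e2
      have e3 := hN0 t
      rw [hδkm] at e3
      rw [e1]
      calc |v t - U.rtest (φ k) t|
          = |(v t - U.rtest (u k) t) - (U.rtest (φ k) t - U.rtest (u k) t)| := by ring_nf
        _ ≤ |v t - U.rtest (u k) t| + |U.rtest (φ k) t - U.rtest (u k) t| := abs_sub _ _
        _ ≤ ε / 2 + 1 / ((m : ℝ) + 1) := add_le_add e2 e3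
        _ ≤ ε := by linarith
    · -- derivatives
      rw [hscaled]
      have e2 := h1 t
      rw [← huk] at e2
      have e3 := hN1 t
      rw [hδkm] at e3
      calc |deriv v t - deriv (U.rtest (φ k)) t|
          = |(deriv v t - deriv (U.rtest (u k)) t) -
              (deriv (U.rtest (φ k)) t - deriv (U.rtest (u k)) t)| := by ring_nf
        _ ≤ |deriv v t - deriv (U.rtest (u k)) t| +
              |deriv (U.rtest (φ k)) t - deriv (U.rtest (u k)) t| := abs_sub _ _
        _ ≤ ε / 2 + 1 / ((m : ℝ) + 1) := add_le_add e2 e3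
        _ ≤ ε := by linarith
  · -- `∫ F_k d*u ∈ ℤ`
    obtain ⟨z, hz⟩ := hLint 0 k
    refine ⟨z, ?_⟩
    change massDstar (toMul (U.rtest (ψ k))) = z
    rw [← U.M₀_eq_massDstar]
    change U.M₀ ((M k : ℝ) • φ k) = z
    simpa [L] using hz
  · -- `∫ F_k du ∈ ℤ`
    obtain ⟨z, hz⟩ := hLint 1 k
    refine ⟨z, ?_⟩
    change massDu (toMul (U.rtest (ψ k))) = z
    rw [← U.M₁_eq_massDu]
    change U.M₁ ((M k : ℝ) • φ k) = z
    simpa [L] using hz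
  · -- `Re W(F_j ⋆ F̃_k) ∈ ℤ`
    obtain ⟨z, hz⟩ := hBint j k
    exact ⟨z, hz⟩

/-! ## §9 Integral canonical carriers -/

/-- Additive maps on the free lattice that are integral on the basis are integral. -/
theorem int_of_additive {ι : Type*} (g : (ι →₀ ℤ) →+ ℝ) (h : ∀ i, ∃ z : ℤ, g (Finsupp.single i 1) = z)
    (c : ι →₀ ℤ) : ∃ z : ℤ, g c = z := by
  induction c using Finsupp.induction with
  | zero => exact ⟨0, by simp⟩
  | single_add a b f _ _ ih =>
    obtain ⟨z, hz⟩ := ih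
    obtain ⟨w, hw⟩ := h a
    refine ⟨b * w + z, ?_⟩
    rw [map_add, hz, ← Finsupp.smul_single_one a b, map_zsmul, hw]
    push_cast
    rw [zsmul_eq_mul]

/-- Biadditive maps on the free lattice that are integral on pairs of basis vectors are
integral. -/
theorem int_of_biadditive {ι : Type*} (f : (ι →₀ ℤ) →+ (ι →₀ ℤ) →+ ℝ)
    (h : ∀ i j, ∃ z : ℤ, f (Finsupp.single i 1) (Finsupp.single j 1) = z) (c c' : ι →₀ ℤ) :
    ∃ z : ℤ, f c c' = z := by
  have h1 : ∀ i c', ∃ z : ℤ, f (Finsupp.single i 1) c' = z := fun i ↦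
    int_of_additive (f (Finsupp.single i 1)) (h i)
  exact int_of_additive (f.flip c') (fun i ↦ h1 i c') c

/-- **The decreed pairing of the canonical carrier is integral** as soon as the prime-side data of
the generators are: masses `∫ φ_i d*u, ∫ φ_i du ∈ ℤ` and cross terms `Re W(φ_i ⋆ φ̃_j) ∈ ℤ`. -/
theorem primeInter_integral (G : GeneratingFamily)
    (h₀ : ∀ i, ∃ z : ℤ, massDstar (toMul (G.φ i)) = z)
    (h₁ : ∀ i, ∃ z : ℤ, massDu (toMul (G.φ i)) = z)
    (h₂ : ∀ i j, ∃ z : ℤ, (weilCross (fun t ↦ (G.φ i t : ℂ)) (fun t ↦ (G.φ j t : ℂ))).re = z)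
    (x y : G.PrimeLattice) : ∃ z : ℤ, G.primeInter x y = z := by
  have hd : ∀ c, ∃ z : ℤ, G.dstarHom c = z := int_of_additive G.dstarHom fun i ↦ by
    rw [G.dstarHom_apply, ForcingUp.testCombination_single]; exact h₀ i
  have hu : ∀ c, ∃ z : ℤ, G.duHom c = z := int_of_additive G.duHom fun i ↦ by
    rw [G.duHom_apply, ForcingUp.testCombination_single]; exact h₁ i
  have hc : ∀ c c', ∃ z : ℤ, G.crossHom c c' = z := int_of_biadditive G.crossHom fun i j ↦ by
    rw [G.crossHom_apply]
    change ∃ z : ℤ, (weilCross (fun t ↦ ((testCombination G.φ (Finsupp.single i 1) t : ℝ) : ℂ))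
      (fun t ↦ ((testCombination G.φ (Finsupp.single j 1) t : ℝ) : ℂ))).re = z
    rw [ForcingUp.testCombination_single, ForcingUp.testCombination_single]; exact h₂ i j
  obtain ⟨z₁, e₁⟩ := hd x.1; obtain ⟨z₂, e₂⟩ := hu y.1; obtain ⟨z₃, e₃⟩ := hd y.1
  obtain ⟨z₄, e₄⟩ := hu x.1; obtain ⟨z₅, e₅⟩ := hc x.1 y.1
  refine ⟨z₁ * z₂ + z₃ * z₄ - z₅ + x.2.1 * z₃ + y.2.1 * z₁ + x.2.2 * z₂ + y.2.2 * z₄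
    + (x.2.1 * y.2.2 + y.2.1 * x.2.2), ?_⟩
  rw [G.primeInter_apply, GeneratingFamily.interFun, e₁, e₂, e₃, e₄, e₅]
  push_cast
  ring

/-- **An integral canonical carrier exists (RH-free).**  There is a generating family (countable
index) whose canonical prime-side carrier has a `ℤ`-valued decreed pairing on the whole free
lattice `(ι →₀ ℤ) × ℤ × ℤ`. -/
theorem exists_integral_primeLattice : ∃ G : GeneratingFamily, Countable G.ι ∧
    ∀ x y : G.PrimeLattice, ∃ z : ℤ, G.primeInter x y = z := by
  obtain ⟨G, hG, h₀, h₁, h₂⟩ := exists_integral_generatingFamily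
  exact ⟨G, hG, primeInter_integral G h₀ h₁ h₂⟩

/-- **INTEGRALITY OF THE PAIRING IS NOT THE MISSING AXIOM** (kernel-exact for literally this
structure): `RH ↔` an arithmetic Weil surface with an INTEGRAL intersection pairing exists.
Forward: the integral canonical carrier with its sign condition supplied by RH
(`primeHodge_iff_riemannHypothesis`); backward: `riemannHypothesis_of_arithmeticWeilSurface`. -/
theorem riemannHypothesis_iff_exists_integral_carrier :
    _root_.RiemannHypothesis ↔
      ∃ X : ArithmeticWeilSurface, ∀ x y : X.L, ∃ n : ℤ, X.inter x y = n := by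
  constructor
  · intro h
    obtain ⟨G, _, hint⟩ := exists_integral_primeLattice
    exact ⟨G.ofHodge (G.primeHodge_iff_riemannHypothesis.mpr h), fun x y ↦ hint x y⟩
  · rintro ⟨X, _⟩
    exact riemannHypothesis_of_arithmeticWeilSurface ⟨X⟩

end IntegralCarrier

end Summit.RiemannHypothesis.RiemannHypothesis.Theorems.MotivicDoor.AWS
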